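import Mathlib
import HarnessLib
import Literature.MathematicalPhysics.QuantumFieldTheory.ConstructiveQFTWave0
import Summits.Ventures.LatticeQCDFlow.Scaling.LatticeEntropy
import Summits.Ventures.LatticeQCDFlow.Scaling.LatticePeeling
import Summits.Ventures.LatticeQCDFlow.Scaling.LatticeGibbs
import Summits.Ventures.LatticeQCDFlow.Scaling.LatticeEntropyGrowth
import Summits.Ventures.LatticeQCDFlow.Scaling.LatticeTreeGauge

/-!
# LatticeQCDFlow / Scaling — SHARP ENTROPY GROWTH of the Wilson measure, PROVED
(THEORY-2.md §3.2 v2.0 (d) / §4 T2-AH(d); R-T2-10, closing the typed item `EntropyGrowth`)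

HONEST FRAMING: exact (Metropolis-corrected) sampling algorithms for lattice gauge theory;
figures of merit are autocorrelation/cost numbers at stated couplings and volumes; no
continuum-physics claim.

`theorem entropyGrowth (d : ℕ) (κ : ℝ) : EntropyGrowth d κ` — the `@[conjecture]` item of
`Scaling/LatticeEntropy.lean` with the SHARP coefficients.  For the Wilson theory of ANY continuous
`ρ` (`Re tr ρ ≤ N`) of ANY compact second-countable `G` on the torus `(ℤ/L)^d`, under the two
ONE-PLAQUETTE hypotheses (H1) `Z₁(β) ≤ A·β^{−κ/2}` and (H2) small balls `B_ε` of Haar mass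
`≥ a·ε^κ` with four-fold plaquette action `≤ b·ε²` (read `κ = dim G`), there is `C` with, for all
`L ≥ 2`, `β ≥ 1`, `V = L^d`,

  `κ·((d−1)·V·(1/2 − 1/L) − 1/2)·log β − C·V ≤ D(μ_{Λ,β} ‖ Haar^{⊗E}) ≤ κ·((d−1)·V + 1)/2·log β + C·V`,

i.e. the relative entropy of the lattice Yang–Mills measure w.r.t. the product-Haar prior — the
budget `log M + E log J ≥ D − log(1/ESS)` every exact flow from that prior must supply
(`Scaling/EntropyBudget.lean`) — is `(n_tr/2)·log β·(1 ± O(1/L)) + O(V)` with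
`n_tr = κ·(d−1)·V` the number of transverse (non-gauge) degrees of freedom.  The lower coefficient
is positive in every `d ≥ 2` as soon as `L ≥ 3` (`d = 2`: `V(1/2 − 1/L) − 1/2 > 0` iff `L ≥ 3`).

ASSEMBLY (as in `crudeEntropyGrowth`, #16, with ONE change): the lower bound on `log Z_Λ(β)` now
comes from the TREE-GAUGE small-ball bound `treeGaugeSmallBallBound` (#17: exponent
`#E − (#V − 1) ≤ (d−1)V + 1` instead of `#E = dV`), at `ε = β^{−1/2}`; the other three inputs are
unchanged — `peelingBound` (#14) at `β/2`, `gibbsIdentity` and `twoFreeEnergies_wilson` (#15) with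
`β₁ = β/2` — plus the bookkeeping `m − ((d−1)V + 1)/2 = (d−1)V(1/2 − 1/L) − 1/2` for
`m = (d−1)L^{d−1}(L−1)`.  The item carries no `0 ≤ κ` hypothesis: (H2) itself forces `0 ≤ κ`
(`nonneg_of_smallBalls`: Haar masses are `≤ 1`).  No instance of (H1)/(H2) is claimed here (they
hold with `κ = dim G` for faithful `ρ`; `U(1)`: `κ = 1`; see the item's docstring); for the trivial
representation they fail and `D = 0`.  Axioms: propext, Classical.choice, Quot.sound.

References: K. Wilson, Phys. Rev. D 10 (1974) 2445 (the action); M. Creutz, *Quarks, gluons and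
lattices* (1983) Ch. 9 (strong/weak coupling free energy); S. Chatterjee, arXiv:1602.01222, Thm 2.1
(the sharp `U(N)` free-box constant, not claimed here).
-/

namespace Summit.Ventures.LatticeQCDFlow.Theory2.Lattice

open MeasureTheory Literature.MathematicalPhysics.QuantumFieldTheory

section Growth

variable {N : ℕ} {G : Type} [Group G] [TopologicalSpace G] [IsTopologicalGroup G]
  [CompactSpace G] [SecondCountableTopology G] [MeasurableSpace G] [BorelSpace G]

omit [SecondCountableTopology G] in
/-- Hypothesis (H2) forces `0 ≤ κ`: sets of Haar mass `≥ a·ε^κ` (`a > 0`) for every `0 < ε ≤ 1`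
cannot exist when `κ < 0`, Haar masses being `≤ 1`. [folklore] -/
theorem nonneg_of_smallBalls {κ a : ℝ} (ha : 0 < a)
    (h : ∀ ε : ℝ, 0 < ε → ε ≤ 1 → ∃ B : Set G, a * ε ^ κ ≤ (haarProbability G B).toReal) :
    0 ≤ κ := by
  by_contra hκ
  push Not at hκ
  set t : ℝ := -κ with ht
  have ht0 : 0 < t := by linarith
  have hκt : κ = -t := by rw [ht, neg_neg]
  have hat : 0 < a ^ (1 / t) := Real.rpow_pos_of_pos ha _
  set ε : ℝ := min 1 (a ^ (1 / t) / 2) with hε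
  have hε0 : 0 < ε := lt_min one_pos (by positivity)
  have hε1 : ε ≤ 1 := min_le_left _ _
  have hεlt : ε < a ^ (1 / t) := lt_of_le_of_lt (min_le_right _ _) (by linarith)
  have hεt : ε ^ t < a := by
    have h1 := Real.rpow_lt_rpow hε0.le hεlt ht0
    rwa [← Real.rpow_mul ha.le, one_div_mul_cancel ht0.ne', Real.rpow_one] at h1
  have hεtpos : 0 < ε ^ t := Real.rpow_pos_of_pos hε0 _
  obtain ⟨B, hB⟩ := h ε hε0 hε1
  have hle1 : (haarProbability G B).toReal ≤ 1 :=
    ENNReal.toReal_le_of_le_ofReal zero_le_one (ENNReal.ofReal_one.symm ▸ prob_le_one)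
  have hgt : 1 < a * ε ^ κ := by
    rw [hκt, Real.rpow_neg hε0.le, ← div_eq_mul_inv, one_lt_div hεtpos]
    exact hεt
  linarith

/-- **T2-AH(d) ENTROPY GROWTH with the sharp coefficients, PROVED** (closes the typed item
`EntropyGrowth` of `Scaling/LatticeEntropy.lean`). [folklore] -/
theorem entropyGrowth (d : ℕ) (κ : ℝ) : EntropyGrowth d κ := by
  intro N G _ _ _ _ _ _ _ ρ hρ htr hH1 hH2
  obtain ⟨A, hA⟩ := hH1
  obtain ⟨a, b, ha, hab⟩ := hH2
  have hκ : 0 ≤ κ := nonneg_of_smallBalls (G := G) ha fun ε hε0 hε1 => by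
    obtain ⟨B, -, hB, -⟩ := hab ε hε0 hε1
    exact ⟨B, hB⟩
  have hApos : 0 < A := by
    have h := hA 1 one_pos
    rw [Real.one_rpow, mul_one] at h
    exact lt_of_lt_of_le (onePlaquetteZ_pos ρ hρ htr 1 zero_le_one) h
  have hb : 0 ≤ b := by
    obtain ⟨B, -, -, hB⟩ := hab 1 one_pos le_rfl
    have h := hB 1 (Set.mem_insert _ _) 1 (Set.mem_insert _ _) 1 (Set.mem_insert _ _)
      1 (Set.mem_insert _ _)
    simpa using h
  have hlog2 : 0 < Real.log 2 := Real.log_pos one_lt_two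
  refine ⟨(d : ℝ) * |Real.log a| + b * (d : ℝ) ^ 2 + 2 * (d : ℝ) * |Real.log A| +
    (d : ℝ) * κ * Real.log 2, fun L _ hL β hβ => ?_⟩
  have hβ0 : 0 < β := by linarith
  have hL1 : (1 : ℝ) ≤ L := by exact_mod_cast (by omega : 1 ≤ L)
  have hL0 : (0 : ℝ) < L := by linarith
  have hLd : (0 : ℝ) < (L : ℝ) ^ d := by positivity
  have hlogβ : 0 ≤ Real.log β := Real.log_nonneg hβ
  have hκlog : 0 ≤ κ / 2 * Real.log β := mul_nonneg (by linarith) hlogβ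
  -- the ball at scale `ε = β^{-1/2}`
  set ε : ℝ := β ^ (-(1 / 2 : ℝ)) with hε
  have hε0 : 0 < ε := Real.rpow_pos_of_pos hβ0 _
  have hε1 : ε ≤ 1 := Real.rpow_le_one_of_one_le_of_nonpos hβ (by norm_num)
  obtain ⟨B, hBm, hBa, hBs⟩ := hab ε hε0 hε1
  have hε2 : β * (b * ε ^ 2) = b := by
    have h2 : ε ^ 2 = β⁻¹ := by
      rw [hε, ← Real.rpow_natCast (β ^ (-(1 / 2 : ℝ))) 2, ← Real.rpow_mul hβ0.le]
      norm_num [Real.rpow_neg_one]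
    rw [h2]
    field_simp
  have haε : 0 < a * ε ^ κ := mul_pos ha (Real.rpow_pos_of_pos hε0 κ)
  have hHpos : 0 < (haarProbability G B).toReal := lt_of_lt_of_le haε hBa
  have f5 : Real.log a - κ / 2 * Real.log β ≤ Real.log (haarProbability G B).toReal := by
    have h := Real.log_le_log haε hBa
    rw [Real.log_mul ha.ne' (Real.rpow_pos_of_pos hε0 κ).ne', Real.log_rpow hε0, hε,
      Real.log_rpow hβ0] at h
    linarith
  -- cardinalities
  have hV : Fintype.card (Site d L) = L ^ d := by simp [ZMod.card, Fintype.card_fin]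
  have hEn : Fintype.card (Edge d L) = L ^ d * d := by
    simp [Fintype.card_prod, ZMod.card, Fintype.card_fin]
  have hE : (Fintype.card (Edge d L) : ℝ) = d * (L : ℝ) ^ d := by
    rw [hEn]
    push_cast
    ring
  have hP : (Fintype.card (Plaquette d L) : ℝ) ≤ (d : ℝ) ^ 2 * (L : ℝ) ^ d := by
    have h1 : Fintype.card (Plaquette d L) =
        L ^ d * Fintype.card {p : Fin d × Fin d // p.1 < p.2} := by
      simp [Fintype.card_prod, ZMod.card, Fintype.card_fin]
    have h2 : Fintype.card {p : Fin d × Fin d // p.1 < p.2} ≤ d * d :=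
      (Fintype.card_subtype_le _).trans (by simp)
    have h3 : (Fintype.card (Plaquette d L) : ℝ) ≤ (L : ℝ) ^ d * (d * d : ℝ) := by
      rw [h1]; push_cast; gcongr; exact_mod_cast h2
    nlinarith [h3]
  -- the tree-gauge exponent `n = #E − (#V − 1)` (`= (d−1)·L^d + 1` for `d ≥ 1`, `0` for `d = 0`)
  set n : ℕ := Fintype.card (Edge d L) - (Fintype.card (Site d L) - 1) with hn
  have hn0 : (0 : ℝ) ≤ n := Nat.cast_nonneg _
  have hnE' : n ≤ Fintype.card (Edge d L) := by
    rw [hn]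
    exact Nat.sub_le _ _
  have hnE : (n : ℝ) ≤ d * (L : ℝ) ^ d := by
    rw [← hE]
    exact_mod_cast hnE'
  have hn_sharp : (n : ℝ) ≤ ((d : ℝ) - 1) * (L : ℝ) ^ d + 1 := by
    rcases Nat.eq_zero_or_pos d with hd | hd
    · subst hd
      have h0 : n = 0 := by rw [hn, hEn]; simp
      rw [h0]
      norm_num
    · have hk : 1 ≤ L ^ d := Nat.one_le_pow _ _ (by omega)
      have h1 : L ^ d - 1 ≤ L ^ d * d :=
        (Nat.sub_le _ _).trans (by simpa using Nat.mul_le_mul_left (L ^ d) hd)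
      have h2 : (n : ℝ) = (L : ℝ) ^ d * d - ((L : ℝ) ^ d - 1) := by
        rw [hn, hEn, hV, Nat.cast_sub h1, Nat.cast_sub hk]
        push_cast
        ring
      rw [h2]
      apply le_of_eq
      ring
  -- the peeling exponent `m`
  set m : ℕ := (d - 1) * L ^ (d - 1) * (L - 1) with hm
  have hm_le : (m : ℝ) ≤ d * (L : ℝ) ^ d := by
    have h : m ≤ d * L ^ d := by
      rcases Nat.eq_zero_or_pos d with hd | hd
      · simp [hm, hd]
      · obtain ⟨n', rfl⟩ : ∃ n', d = n' + 1 := ⟨d - 1, by omega⟩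
        simp only [hm, Nat.add_sub_cancel]
        calc n' * L ^ n' * (L - 1) ≤ (n' + 1) * L ^ n' * L := by
              gcongr <;> omega
          _ = (n' + 1) * L ^ (n' + 1) := by ring
    exact_mod_cast h
  have hm0 : (0 : ℝ) ≤ m := Nat.cast_nonneg _
  have hcoef : ((d : ℝ) - 1) * (L : ℝ) ^ d * (1 / 2 - 1 / L) - 1 / 2 ≤
      (m : ℝ) - (((d : ℝ) - 1) * (L : ℝ) ^ d + 1) / 2 := by
    rcases Nat.eq_zero_or_pos d with hd | hd
    · subst hd
      have hm_zero : (m : ℝ) = 0 := by simp [hm]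
      have hinv : (L : ℝ)⁻¹ ≤ 1 := inv_le_one_of_one_le₀ hL1
      rw [hm_zero, pow_zero, Nat.cast_zero]
      have e : ((0 : ℝ) - 1) * 1 * (1 / 2 - 1 / (L : ℝ)) - 1 / 2 = -1 + (L : ℝ)⁻¹ := by ring
      have e2 : (0 : ℝ) - (((0 : ℝ) - 1) * 1 + 1) / 2 = 0 := by ring
      rw [e, e2]
      linarith
    · obtain ⟨n', rfl⟩ : ∃ n', d = n' + 1 := ⟨d - 1, by omega⟩
      have hcast : (m : ℝ) = n' * (L : ℝ) ^ n' * ((L : ℝ) - 1) := by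
        simp only [hm, Nat.add_sub_cancel]
        push_cast [Nat.cast_sub (by omega : 1 ≤ L)]
        ring
      rw [hcast]
      apply le_of_eq
      push_cast
      field_simp
      ring
  -- the four proved ingredients
  have hZpos : 0 < (partitionFunction (d := d) (L := L) ρ β).toReal :=
    ENNReal.toReal_pos (partitionFunction_ne_zero ρ hρ β)
      (ne_top_of_le_ne_top ENNReal.one_ne_top (partitionFunction_le_one ρ htr hβ0.le))
  have hZhpos : 0 < (partitionFunction (d := d) (L := L) ρ (β / 2)).toReal :=
    ENNReal.toReal_pos (partitionFunction_ne_zero ρ hρ (β / 2))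
      (ne_top_of_le_ne_top ENNReal.one_ne_top (partitionFunction_le_one ρ htr (by positivity)))
  -- (1) tree-gauged small balls at `β`
  have f1 : (n : ℝ) * Real.log (haarProbability G B).toReal -
      b * Fintype.card (Plaquette d L) ≤
        Real.log (partitionFunction (d := d) (L := L) ρ β).toReal := by
    have hSB := treeGaugeSmallBallBound d N G ρ hρ htr L β hβ0.le B hBm (b * ε ^ 2) hBs
    rw [hε2, ← hn] at hSB
    have hpos : 0 < (haarProbability G B).toReal ^ n *
        Real.exp (-(b * Fintype.card (Plaquette d L))) := by positivity
    have h := Real.log_le_log hpos hSB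
    rw [Real.log_mul (pow_pos hHpos _).ne' (Real.exp_pos _).ne', Real.log_pow, Real.log_exp] at h
    linarith
  -- (2) two free energies at `β₁ = β/2`
  have f2 : Real.log (partitionFunction (d := d) (L := L) ρ β).toReal -
      2 * Real.log (partitionFunction (d := d) (L := L) ρ (β / 2)).toReal ≤
        (InformationTheory.klDiv (wilsonMeasure (d := d) (L := L) ρ β)
          (Measure.pi fun _ : Edge d L => haarProbability G)).toReal := by
    have h := twoFreeEnergies_wilson (d := d) (L := L) ρ hρ htr β (β / 2) hβ0.le (by positivity)
    have h2 : (0 : ℝ) < β / 2 := by positivity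
    rw [show β - β / 2 = β / 2 by ring] at h
    refine le_of_mul_le_mul_left ?_ h2
    linarith
  -- (3) peeling at `β/2`
  have f3 : Real.log (partitionFunction (d := d) (L := L) ρ (β / 2)).toReal ≤
      m * Real.log (onePlaquetteZ ρ (β / 2)) := by
    have h := Real.log_le_log hZhpos (peelingBound d N G ρ hρ htr L hL (β / 2) (by positivity))
    rwa [Real.log_pow] at h
  -- (4) one-plaquette decay at `β/2`
  have f4 : Real.log (onePlaquetteZ ρ (β / 2)) ≤
      Real.log A - κ / 2 * (Real.log β - Real.log 2) := by
    have hβ2 : 0 < β / 2 := by positivity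
    have h := Real.log_le_log (onePlaquetteZ_pos ρ hρ htr (β / 2) hβ2.le) (hA (β / 2) hβ2)
    rw [Real.log_mul hApos.ne' (Real.rpow_pos_of_pos hβ2 _).ne', Real.log_rpow hβ2,
      Real.log_div hβ0.ne' two_ne_zero] at h
    linarith
  -- (5) Gibbs: `D ≤ −log Z`
  have f6 : (InformationTheory.klDiv (wilsonMeasure (d := d) (L := L) ρ β)
        (Measure.pi fun _ : Edge d L => haarProbability G)).toReal ≤
      -Real.log (partitionFunction (d := d) (L := L) ρ β).toReal := by
    have hG := gibbsIdentity d N G ρ hρ htr L β hβ0.le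
    have hES : 0 ≤ wilsonExpectation (d := d) (L := L) ρ β (wilsonAction (d := d) (L := L) ρ) := by
      unfold wilsonExpectation
      exact integral_nonneg fun U => wilsonAction_nonneg ρ htr U
    have := mul_nonneg hβ0.le hES
    linarith
  -- products for the linear arithmetic
  have g34 : (m : ℝ) * Real.log (onePlaquetteZ ρ (β / 2)) ≤
      m * (Real.log A - κ / 2 * (Real.log β - Real.log 2)) := mul_le_mul_of_nonneg_left f4 hm0
  have g5 : (n : ℝ) * (Real.log a - κ / 2 * Real.log β) ≤
      n * Real.log (haarProbability G B).toReal := mul_le_mul_of_nonneg_left f5 hn0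
  have gnk : κ / 2 * Real.log β * n ≤ κ / 2 * Real.log β * (((d : ℝ) - 1) * (L : ℝ) ^ d + 1) :=
    mul_le_mul_of_nonneg_left hn_sharp hκlog
  have gco : κ * Real.log β * (((d : ℝ) - 1) * (L : ℝ) ^ d * (1 / 2 - 1 / L) - 1 / 2) ≤
      κ * Real.log β * ((m : ℝ) - (((d : ℝ) - 1) * (L : ℝ) ^ d + 1) / 2) :=
    mul_le_mul_of_nonneg_left hcoef (mul_nonneg hκ hlogβ)
  have gP : b * (Fintype.card (Plaquette d L) : ℝ) ≤ b * ((d : ℝ) ^ 2 * (L : ℝ) ^ d) :=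
    mul_le_mul_of_nonneg_left hP hb
  have gm1 : (m : ℝ) * |Real.log A| ≤ d * (L : ℝ) ^ d * |Real.log A| :=
    mul_le_mul_of_nonneg_right hm_le (abs_nonneg _)
  have gm2 : (m : ℝ) * Real.log A ≤ m * |Real.log A| :=
    mul_le_mul_of_nonneg_left (le_abs_self _) hm0
  have gm3 : (m : ℝ) * (κ * Real.log 2) ≤ d * (L : ℝ) ^ d * (κ * Real.log 2) :=
    mul_le_mul_of_nonneg_right hm_le (mul_nonneg hκ hlog2.le)
  have ga1 : (n : ℝ) * (-|Real.log a|) ≤ n * Real.log a :=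
    mul_le_mul_of_nonneg_left (neg_abs_le _) hn0
  have ga2 : (n : ℝ) * Real.log a ≤ n * |Real.log a| :=
    mul_le_mul_of_nonneg_left (le_abs_self _) hn0
  have ga3 : (n : ℝ) * |Real.log a| ≤ d * (L : ℝ) ^ d * |Real.log a| :=
    mul_le_mul_of_nonneg_right hnE (abs_nonneg _)
  have gn1 : 0 ≤ d * (L : ℝ) ^ d * |Real.log A| := by positivity
  have gn2 : 0 ≤ d * (L : ℝ) ^ d * (κ * Real.log 2) := by positivity
  constructor
  · linarith
  · linarith

end Growth

end Summit.Ventures.LatticeQCDFlow.Theory2.Lattice
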